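import Literature.AlgebraicTopology.Homotopy.CompactENRCWType
import Literature.AlgebraicTopology.Homotopy.ENRTheorem
import Literature.AlgebraicTopology.Homotopy.CWTypeCompactBoundaryProofs
import Literature.AlgebraicTopology.Homotopy.SequenceTelescopeCW
import Literature.AlgebraicTopology.Homotopy.CellularApproximationProofs
import HarnessLib

/-!
# A compact manifold is homotopy equivalent to a CW complex (Hatcher, Cor. A.12) — proof file

Sibling proof file (D-0014) of `WhiteheadTheorem.lean` / `CompactManifoldCWType.lean`. The named
fact `Literature.AlgebraicTopology.Homotopy.exists_cwComplex_homotopyEquiv_of_compactSpace`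
(`WhiteheadTheorem.lean`; Hatcher, *Algebraic Topology* (2002), Cor. A.12: "A compact manifold
is homotopy equivalent to a CW complex", stated for closed topological `n`-manifolds) is
DISCHARGED here, along Hatcher's Appendix:

* Thm. A.7 (compact locally contractible subsets of `ℝᴺ` are neighbourhood retracts), PROVED in
  `ENRTheorem.lean` (`isNeighbourhoodRetract_of_locallyContractibleSpace_holds`);
* Cor. A.9 (compact manifolds embed in `ℝᴺ`, `TopologicalEmbedding.lean`, and are locally
  contractible, `NeighbourhoodRetract.lean`), Cor. A.8 / Prop. A.11 for compact ENRs (cube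
  complex neighbourhood, mapping telescopes, cellular approximation on cube complexes), PROVED
  in `CompactENRCWType.lean` (`exists_cwComplex_homotopyEquiv_of_compactSpace_of_A7`).

* `Literature.AlgebraicTopology.Homotopy.exists_cwComplex_homotopyEquiv_of_compactSpace_holds`.

Appended (2026-08-15): the companion fact for compact manifolds WITH boundary,
`Literature.AlgebraicTopology.Homotopy.exists_cwComplex_homotopyEquiv_of_compactSpace_boundary`
(`CWTypeCompactBoundary.lean`; Hatcher Cor. A.12 with Cor. A.9: "Every compact manifold, with or
without boundary, is an ENR"), is DISCHARGED by the same two theorems — Thm. A.7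
(`isNeighbourhoodRetract_of_locallyContractibleSpace_holds`) and the CW type of compact ENRs
(`exists_cwComplex_homotopyEquiv_of_isNeighbourhoodRetract'`) — through the boundary-case
embedding and local contractibility of `CWTypeCompactBoundaryProofs.lean`
(`exists_isClosedEmbedding_pi_of_compactSpace_halfSpace`,
`isNeighbourhoodRetract_range_of_compactSpace_halfSpace`):

* `Literature.AlgebraicTopology.Homotopy.exists_cwComplex_homotopyEquiv_of_compactSpace_boundary_holds`.

Appended (2026-08-15, second addition): **Hatcher's Proposition A.11 in full generality**, the named fact
`Literature.AlgebraicTopology.Homotopy.exists_cwComplex_homotopyEquiv_of_dominated`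
(`CompactManifoldCWType.lean`; Hatcher p. 528: "A space dominated by a CW complex is homotopy
equivalent to a CW complex"), is DISCHARGED by the printed mapping-telescope argument — for a
domination `Y →ⁱ X →ʳ Y`, `r ∘ i ≃ 𝟙`,

  `Y ≃ T(𝟙, 𝟙, …) ≃ T(ri, ri, …) ≃ T(ir, ir, …) ≃ T(g, g, …)`, `g ≃ i ∘ r` cellular,

using the tree's abstract telescope of a sequence (`SequenceTelescope.lean`:
`SeqTelescope.homotopyEquivOfId`, `SeqTelescope.homotopyEquivOfHomotopy` = Hatcher's fact (1),
`SeqTelescope.homotopyEquivOfFactorization` = facts (2)+(3) for a domination), its Hausdorffness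
(`SequenceTelescopeHausdorff.lean`) and CW structure for cellular bonding maps
(`SequenceTelescopeCW.lean`: `SeqTelescope.cwComplex`), and the cellular approximation theorem
PROVED in `CellularApproximationProofs.lean` (`cellularApproximation_holds`, Hatcher Thm. 4.8):

* `Literature.AlgebraicTopology.Homotopy.exists_cwComplex_homotopyEquiv_of_dominated_holds`.

No `sorry`, no hypotheses.

## References

* A. Hatcher, *Algebraic Topology*, CUP (2002), Appendix, Thm. A.7, Cor. A.8, Cor. A.9,
  Prop. A.11 (statement p. 528, proof pp. 528–529), Cor. A.12 (pp. 525–529); §4.1 Thm. 4.8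
  (cellular approximation, p. 349). [HatcherAT2002]
-/

noncomputable section

universe u

namespace Literature.AlgebraicTopology.Homotopy

/-- **Hatcher's Corollary A.12, proved**: every compact Hausdorff topological `n`-manifold
(without boundary) is homotopy equivalent to a (Hausdorff) CW complex — the named fact
`exists_cwComplex_homotopyEquiv_of_compactSpace` holds outright (Thm. A.7 proved in
`ENRTheorem.lean`, the rest in `CompactENRCWType.lean`). [cite: HatcherAT2002, Cor. A.12] -/
theorem exists_cwComplex_homotopyEquiv_of_compactSpace_holds :
    exists_cwComplex_homotopyEquiv_of_compactSpace.{u} :=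
  exists_cwComplex_homotopyEquiv_of_compactSpace_of_A7
    isNeighbourhoodRetract_of_locallyContractibleSpace_holds

/-- **Hatcher's Corollary A.12, boundary case, proved**: every compact Hausdorff topological
`(n+1)`-manifold with boundary (charts on `EuclideanHalfSpace (n + 1)`) is homotopy equivalent to a
(Hausdorff) CW complex — the named fact `exists_cwComplex_homotopyEquiv_of_compactSpace_boundary`
(`CWTypeCompactBoundary.lean`) holds outright. Proof (Hatcher 2002, Cor. A.9 ⇒ Cor. A.12): embed
the compact `W` in `ℝᴺ` (`exists_isClosedEmbedding_pi_of_compactSpace_halfSpace`); the image is a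
neighbourhood retract by Thm. A.7 (`isNeighbourhoodRetract_of_locallyContractibleSpace_holds`,
through `isNeighbourhoodRetract_range_of_compactSpace_halfSpace`); a compact Euclidean
neighbourhood retract is homotopy equivalent to a CW complex
(`exists_cwComplex_homotopyEquiv_of_isNeighbourhoodRetract'`, Prop. A.11 for compact ENRs).
[cite: HatcherAT2002, Cor. A.12 (with Thm. A.7, Cor. A.9, Prop. A.11)] -/
theorem exists_cwComplex_homotopyEquiv_of_compactSpace_boundary_holds :
    exists_cwComplex_homotopyEquiv_of_compactSpace_boundary.{u} := by
  intro n W _ _ _ _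
  obtain ⟨N, f, hf⟩ :=
    Geometry.Manifold.exists_isClosedEmbedding_pi_of_compactSpace_halfSpace (M := W) (n + 1)
  exact exists_cwComplex_homotopyEquiv_of_isNeighbourhoodRetract' hf (isCompact_range hf.continuous)
    (isNeighbourhoodRetract_range_of_compactSpace_halfSpace
      isNeighbourhoodRetract_of_locallyContractibleSpace_holds (n + 1) hf.isEmbedding)

/-! ### Hatcher's Proposition A.11, proved -/

open Set _root_.Topology in
open scoped ContinuousMap in
/-- **A space dominated by a CW complex is homotopy equivalent to a CW complex** (Hatcher,
*Algebraic Topology* (2002), Appendix, Prop. A.11, p. 528), discharging the named fact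
`exists_cwComplex_homotopyEquiv_of_dominated` (`CompactManifoldCWType.lean`) outright: for every
space `Y`, every Hausdorff space `X` with a classical CW structure `Topology.CWComplex univ` (same
universe) and maps `i : C(Y, X)`, `r : C(X, Y)` with `r ∘ i ≃ 𝟙`, the space `Y` is homotopy
equivalent to a Hausdorff CW complex. Proof as printed (Hatcher pp. 528–529): by cellular
approximation (Thm. 4.8, `cellularApproximation_holds`) `i ∘ r ≃ g` with `g` cellular, and
`Y ≃ T(𝟙_Y, 𝟙_Y, …)` (`SeqTelescope.homotopyEquivOfId`) `≃ T(ri, ri, …)` (fact (1),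
`SeqTelescope.homotopyEquivOfHomotopy`) `≃ T(ir, ir, …)` (facts (2)+(3) for the factorization
through `i`, `r`: `SeqTelescope.homotopyEquivOfFactorization`) `≃ T(g, g, …)` (fact (1) again),
the last telescope being a Hausdorff CW complex (`SeqTelescope.instT2Space`,
`SeqTelescope.cwComplex`: the cells of `∐ₙ X × [n, n+1]`, closure-finite because `g` is
cellular). [cite: HatcherAT2002, Prop. A.11 (p. 528)] -/
theorem exists_cwComplex_homotopyEquiv_of_dominated_holds :
    exists_cwComplex_homotopyEquiv_of_dominated.{u} := by
  intro Y _ X _ _ _ i r hri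
  -- a cellular approximation `g` of `i ∘ r : X → X` (Hatcher Thm. 4.8)
  obtain ⟨g, hg, hgg⟩ := cellularApproximation_holds X X (i.comp r)
  -- the telescope `T(g, g, …)` is a Hausdorff CW complex
  letI inst : CWComplex (univ : Set (SeqTelescope (X := fun _ => X) fun _ => g)) :=
    SeqTelescope.cwComplex (X := fun _ => X) (fun _ => g) fun _ => hg
  refine ⟨SeqTelescope (X := fun _ => X) fun _ => g, inferInstance, inferInstance, inst, ⟨?_⟩⟩
  -- `Y ≃ T(𝟙, 𝟙, …)`
  have e1 : Y ≃ₕ SeqTelescope (X := fun _ => Y) (fun _ => ContinuousMap.id Y) :=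
    (SeqTelescope.homotopyEquivOfId Y).symm
  -- `T(𝟙, 𝟙, …) ≃ T(ri, ri, …)` since `𝟙 ≃ ri` (fact (1))
  have e2 : SeqTelescope (X := fun _ => Y) (fun _ => ContinuousMap.id Y) ≃ₕ
      SeqTelescope (X := fun _ => Y) (fun _ => r.comp i) :=
    SeqTelescope.homotopyEquivOfHomotopy (f := fun _ => ContinuousMap.id Y)
      (f' := fun _ => r.comp i) fun _ => hri.symm.some
  -- `T(ri, ri, …) ≃ T(ir, ir, …)` (facts (2) and (3): both are `≃ T(i, r, i, r, …)`)
  have e3 : SeqTelescope (X := fun _ => Y) (fun _ => r.comp i) ≃ₕ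
      SeqTelescope (X := fun _ => X) (fun _ => i.comp r) :=
    SeqTelescope.homotopyEquivOfFactorization (X := fun _ => Y) (Y := fun _ => X)
      (fun _ => r.comp i) (fun _ => i.comp r) (fun _ => i) (fun _ => r) (fun _ _ => rfl)
      (fun _ _ => rfl)
  -- `T(ir, ir, …) ≃ T(g, g, …)` since `ir ≃ g` (fact (1))
  have e4 : SeqTelescope (X := fun _ => X) (fun _ => i.comp r) ≃ₕ
      SeqTelescope (X := fun _ => X) (fun _ => g) :=
    SeqTelescope.homotopyEquivOfHomotopy (f := fun _ => i.comp r) (f' := fun _ => g)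
      fun _ => hgg.some
  exact ((e1.trans e2).trans e3).trans e4

end Literature.AlgebraicTopology.Homotopy

end
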